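import Summits.AtomisticToContinuum.Crystallization.Theorems.FrustratedLawDichotomyPeriodicBlockViolation

/-!
# FrustratedLawDichotomy · crux `AperiodicFrustratedLawGap` (stmt-AtomisticToContinuum-27623) — PERIODIC-BLOCK NEGATIVE KERNEL, part D:
# PER-CLASS FLAGS (mixed and ALL-BAD cells) — decomp-a2c, prover hand 2, structural share, generation 16

Part C (`…PeriodicBlockViolation.not_pairLevelLaw_of_cell`) refutes a pair-level law `c₀·N + c₁·#good(η₀) + c₂·#good(η₁) ≤ U_W − A·N` on a periodic
cell all of whose classes are `η₁`-good and `η₀`-bad (interior level `c₀ + c₂`).  hand-1's T-side witness (`cell_T_1255`, every site `1/8`-BAD, critic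
rows 555/564) has interior level `c₀ = eUp + κ_T` instead, which part C cannot express.  This file proves the kernel for ARBITRARY certified class
flags `i₀ m, i₁ m ∈ {0,1}` (`not_pairLevelLaw_of_cell_flags`, levels `c₀ + c₁ i₀ m + c₂ i₁ m`) and derives:
* `not_schurTopologicalPricing_of_cell_allBad` — ★ ¬T′♭(κ_T; C_T) for EVERY `C_T` from an all-`η₁`-bad cell with deficit below `eUp + κ_T`;
* `not_schurElasticPricing_of_cell_flags` — ¬E′♭(κ_E; C_E, D_E) from any flagged cell with deficit below `Σ_m [(eUp − D_E) − (κ_E + C_E) i₀ m + (κ_E + D_E) i₁ m]`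
  (for FIXED `C_E, D_E`; the all-strained case of part C is the one uniform in `C_E, D_E`);
* `not_schurRangeGap_of_cell_allBad` — ¬FRG♭(e₁; C) for every `C` from an all-`1/20`-bad cell with deficit below `e₁`;
* `flags_of_allBad`, `flags_of_good` — the two uniform flag patterns.
All `[folklore]`; 0 sorry; no definitions.
-/

noncomputable section

namespace Summit.AtomisticToContinuum.Crystallization.Theorems.FrustratedLawDichotomyPeriodicBlockFlags

open scoped BigOperators Classical
open Metric
open Literature.MathematicalPhysics.StatisticalMechanics (interactionEnergy lennardJones)
open Summit.AtomisticToContinuum.Crystallization.Theorems.ChargedEnergyGapNegative (E3)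
open Summit.AtomisticToContinuum.Crystallization.Theorems.FrustratedLawDichotomyRangeCut
open Summit.AtomisticToContinuum.Crystallization.Theorems.FrustratedLawDichotomyMotifLemmas (GoodAtScale)
open Summit.AtomisticToContinuum.Crystallization.Theorems.FrustratedLawDichotomyMotifDoorE (MaybeGoodAt)
open Summit.AtomisticToContinuum.Crystallization.Theorems.FrustratedLawDichotomySchurCut
open Summit.AtomisticToContinuum.Crystallization.Theorems.FrustratedLawDichotomyPeriodicBlockGeometry
open Summit.AtomisticToContinuum.Crystallization.Theorems.FrustratedLawDichotomyPeriodicBlockKernel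
open Summit.AtomisticToContinuum.Crystallization.Theorems.FrustratedLawDichotomyPeriodicBlockViolation

/-! ## §1. The kernel with per-class flags -/

/-- ★★ **THE PERIODIC-BLOCK NEGATIVE KERNEL WITH PER-CLASS FLAGS** (generalises `…PeriodicBlockViolation.not_pairLevelLaw_of_cell`, whose classes
are all `(η₁-good, η₀-bad)`).  Cell data as in part B; `W` vanishing from `R` on (`0 ≤ R ≤ ϱ`) and `≤ Wsup` on `[7/10, ∞)`; for each class `m` and each
tolerance `η_s` (`s = 0, 1`, both `≤ 3/10`) a CERTIFIED FLAG `i_s m ∈ {0, 1}`: `i_s m = 1` with a capped-goodness certificate `GoodAtScale η_s D` of the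
class centre in the supercell motif, or `i_s m = 0` with a badness certificate `¬ MaybeGoodAt η_s D` (`13/10·D + 1 ≤ ϱ`; certificates e.g. from
`…ShellGoodnessCert` / `…ShellBadnessCert`).  If the priced site energies fall short of the CLASS LEVELS `c₀ + c₁·i₀ m + c₂·i₁ m` in total by
`N₀·δ`, `δ > 0`, then `¬ PairLevelLaw W A c₀ c₁ c₂ η₀ η₁` (same block argument: interior sites realise exactly their class flags and levels, the
`O(n²)` boundary is absorbed).  Covers all-strained cells (`i₀ = 0, i₁ = 1`), ALL-BAD cells (`i₀ = i₁ = 0`) and mixed cells. [folklore] -/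
theorem not_pairLevelLaw_of_cell_flags {N₀ M k₀ : ℕ} {x : Fin N₀ → E3} {a b : Fin 3 → E3} {cB ϱ diam : ℝ} (hN₀ : 1 ≤ N₀)
    (hsep : PerSep x a) (hdual : ∀ j k, inner ℝ (b j) (a k) = if j = k then (1 : ℝ) else 0) (hb : ∀ j, ‖b j‖ ≤ cB)
    (hdiam : DiamLE x diam) (hk₀ : cB * (ϱ + diam) < k₀ + 1)
    {μ : Fin M → Fin N₀} {σ : Fin M → Fin 3 → ℤ} (hμσ : Function.Injective fun q => (μ q, σ q)) (hσ : ∀ q k, |σ q k| ≤ k₀)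
    (hsup : ∀ (m : Fin N₀) (s : Fin 3 → ℤ), (∀ k, |s k| ≤ k₀) → ∃ q, μ q = m ∧ σ q = s)
    {cidx : Fin N₀ → Fin M} (hc : ∀ m, μ (cidx m) = m ∧ σ (cidx m) = 0)
    {W : ℝ → ℝ} {R Wsup : ℝ} (hR0 : 0 ≤ R) (hW : ∀ r, R ≤ r → W r = 0) (hRϱ : R ≤ ϱ)
    (hWle : ∀ r, (7 : ℝ) / 10 ≤ r → W r ≤ Wsup) (hWsup : 0 ≤ Wsup)
    {η₀ η₁ D : ℝ} (hD : 13 / 10 * D + 1 ≤ ϱ) (hη₀ : η₀ ≤ 3 / 10) (hη₁ : η₁ ≤ 3 / 10) {i₀ i₁ : Fin N₀ → ℝ}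
    (hfl₀ : ∀ m, (i₀ m = 1 ∧ GoodAtScale η₀ D (superMotif x a μ σ) (cidx m)) ∨ (i₀ m = 0 ∧ ¬ MaybeGoodAt η₀ D (superMotif x a μ σ) (cidx m)))
    (hfl₁ : ∀ m, (i₁ m = 1 ∧ GoodAtScale η₁ D (superMotif x a μ σ) (cidx m)) ∨ (i₁ m = 0 ∧ ¬ MaybeGoodAt η₁ D (superMotif x a μ σ) (cidx m)))
    {A δ : ℝ} (hδ : 0 < δ) {c₀ c₁ c₂ : ℝ}
    (hdef : ∑ m, (((∑ q, W (dist (x m) (superMotif x a μ σ q))) - W 0) / 2 - A) ≤ (∑ m, (c₀ + c₁ * i₀ m + c₂ * i₁ m)) - N₀ * δ) :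
    ¬ PairLevelLaw W A c₀ c₁ c₂ η₀ η₁ := by
  intro hlaw
  -- boundary relief per site and the block size
  set β : ℝ := max (((20 * R / 7 + 1) ^ 3 * Wsup) / 2 - A - c₀ - min c₁ 0 - min c₂ 0) 0 with hβ
  have hβ0 : 0 ≤ β := le_max_right _ _
  have hβle : ((20 * R / 7 + 1) ^ 3 * Wsup) / 2 - A - c₀ - min c₁ 0 - min c₂ 0 ≤ β := le_max_left _ _
  obtain ⟨n, hn4, hn1, hbig⟩ : ∃ n : ℕ, 4 * k₀ ≤ n ∧ 1 ≤ n ∧ 48 * (k₀ : ℝ) * β < δ * n := by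
    obtain ⟨n₁, hn₁⟩ := exists_nat_gt (48 * (k₀ : ℝ) * β / δ)
    refine ⟨max (4 * k₀ + 1) n₁, by omega, by omega, ?_⟩
    have h1 : (n₁ : ℝ) ≤ ((max (4 * k₀ + 1) n₁ : ℕ) : ℝ) := by exact_mod_cast le_max_right _ _
    rw [div_lt_iff₀ hδ] at hn₁
    nlinarith
  -- re-index the `n`-block by `Fin N`
  suffices key : ∀ (N : ℕ) (e : (Fin N₀ × (Fin 3 → Fin n)) ≃ Fin N), False from key _ (Fintype.equivFin _)
  intro N e
  have hNcard : Fintype.card (Fin N₀ × (Fin 3 → Fin n)) = N := card_reindex e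
  have hNval : (N : ℝ) = N₀ * (n : ℝ) ^ 3 := by
    rw [← hNcard, Fintype.card_prod, Fintype.card_fin, Fintype.card_fun, Fintype.card_fin, Fintype.card_fin]
    push_cast
    ring
  have hYsep := block_sep hsep n
  have hYinj := block_injective hsep n
  have hmain := hlaw N (block x a n ∘ e.symm) (injective_reindex e hYinj) (sep_reindex e hYsep)
  have h2U := interactionEnergy_reindex e (block x a n) W
  have hg₀ := goodCount_reindex e (block x a n) η₀
  have hg₁ := goodCount_reindex e (block x a n) η₁
  -- abbreviations: the flags, the site sums, the class deficits
  set ind₀ : Fin N₀ × (Fin 3 → Fin n) → ℝ := fun p => if GoodAt η₀ (block x a n ∘ e.symm) (e p) then (1 : ℝ) else 0 with hind₀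
  set ind₁ : Fin N₀ × (Fin 3 → Fin n) → ℝ := fun p => if GoodAt η₁ (block x a n ∘ e.symm) (e p) then (1 : ℝ) else 0 with hind₁
  set S : Fin N₀ × (Fin 3 → Fin n) → ℝ := fun p => ∑ q, W (dist (block x a n p) (block x a n q)) with hSdef
  set r : Fin N₀ → ℝ := fun m => ((∑ q, W (dist (x m) (superMotif x a μ σ q))) - W 0) / 2 - A with hr
  set lev : Fin N₀ → ℝ := fun m => c₀ + c₁ * i₀ m + c₂ * i₁ m with hlev
  -- the doubled per-site excess has non-negative total (this is the law on the block)
  set X : Fin N₀ × (Fin 3 → Fin n) → ℝ := fun p => S p - W 0 - 2 * A - 2 * c₀ - 2 * c₁ * ind₀ p - 2 * c₂ * ind₁ p with hX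
  have hXsum : ∑ p, X p = (∑ p, S p) - N * W 0 - N * (2 * A) - N * (2 * c₀) - 2 * c₁ * (∑ p, ind₀ p) - 2 * c₂ * (∑ p, ind₁ p) := by
    simp only [hX, Finset.sum_sub_distrib, Finset.sum_const, Finset.card_univ, hNcard, nsmul_eq_mul, ← Finset.mul_sum]
  have hsumX : 0 ≤ ∑ p, X p := by
    rw [hXsum]
    rw [hg₀, hg₁] at hmain
    linarith only [hmain, h2U]
  -- interior sites: exact site sum, flags `(bad, good)`
  have hint : ∀ p : Fin N₀ × (Fin 3 → Fin n), Interior k₀ n p.2 → X p = 2 * (r p.1 - lev p.1) := by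
    rintro ⟨m, t⟩ ht
    have hS : S (m, t) = ∑ q, W (dist (x m) (superMotif x a μ σ q)) := by
      simp only [hSdef]
      exact siteSum_block_eq (n := n) hsep hdual hb hdiam hk₀ hμσ hσ hsup hW hRϱ ht m
    have h0 : ind₀ (m, t) = i₀ m := by
      rcases hfl₀ m with ⟨hi, hG⟩ | ⟨hi, hB⟩
      · rw [hi]; simp only [hind₀]
        exact if_pos (goodAt_block_of_superMotif hdual hb hdiam hk₀ hσ hsup hc hD e ht hG)
      · rw [hi]; simp only [hind₀]
        exact if_neg (not_goodAt_block_of_superMotif hsep hdual hb hdiam hk₀ hμσ hσ hsup hc hD hη₀ e ht hB)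
    have h1 : ind₁ (m, t) = i₁ m := by
      rcases hfl₁ m with ⟨hi, hG⟩ | ⟨hi, hB⟩
      · rw [hi]; simp only [hind₁]
        exact if_pos (goodAt_block_of_superMotif hdual hb hdiam hk₀ hσ hsup hc hD e ht hG)
      · rw [hi]; simp only [hind₁]
        exact if_neg (not_goodAt_block_of_superMotif hsep hdual hb hdiam hk₀ hμσ hσ hsup hc hD hη₁ e ht hB)
    simp only [hX, hr, hlev, h0, h1, hS]
    ring
  -- boundary sites: `X p ≤ 2β`
  have hbdry : ∀ p : Fin N₀ × (Fin 3 → Fin n), X p ≤ 2 * β := by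
    intro p
    have hS : S p ≤ W 0 + (20 * R / 7 + 1) ^ 3 * Wsup := by
      simp only [hSdef]
      exact siteSum_le_of_sep hYinj hYsep hR0 hW hWle hWsup p
    have h₀ : min c₁ 0 ≤ c₁ * ind₀ p := by
      by_cases hq : GoodAt η₀ (block x a n ∘ e.symm) (e p)
      · have : ind₀ p = 1 := by simp only [hind₀]; exact if_pos hq
        rw [this, mul_one]; exact min_le_left _ _
      · have : ind₀ p = 0 := by simp only [hind₀]; exact if_neg hq
        rw [this, mul_zero]; exact min_le_right _ _
    have h₁ : min c₂ 0 ≤ c₂ * ind₁ p := by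
      by_cases hq : GoodAt η₁ (block x a n ∘ e.symm) (e p)
      · have : ind₁ p = 1 := by simp only [hind₁]; exact if_pos hq
        rw [this, mul_one]; exact min_le_left _ _
      · have : ind₁ p = 0 := by simp only [hind₁]; exact if_neg hq
        rw [this, mul_zero]; exact min_le_right _ _
    have hXp : X p = S p - W 0 - 2 * A - 2 * c₀ - 2 * c₁ * ind₀ p - 2 * c₂ * ind₁ p := rfl
    rw [hXp]
    linarith only [hS, h₀, h₁, hβle]
  -- split the total into interior and boundary
  have hsplit := (Finset.sum_filter_add_sum_filter_not (Finset.univ : Finset (Fin N₀ × (Fin 3 → Fin n)))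
    (fun p => Interior k₀ n p.2) X).symm
  have hI : ∑ p ∈ Finset.univ.filter (fun p : Fin N₀ × (Fin 3 → Fin n) => Interior k₀ n p.2), X p =
      (interiorSet k₀ n).card * ∑ m, 2 * (r m - lev m) := by
    rw [← sum_interior_class]
    exact Finset.sum_congr rfl fun p hp => hint p (Finset.mem_filter.1 hp).2
  have hB : ∑ p ∈ Finset.univ.filter (fun p : Fin N₀ × (Fin 3 → Fin n) => ¬ Interior k₀ n p.2), X p ≤
      N₀ * ((n : ℝ) ^ 3 - (interiorSet k₀ n).card) * (2 * β) := by
    rw [← card_boundary N₀ k₀ n]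
    have := Finset.sum_le_card_nsmul (Finset.univ.filter (fun p : Fin N₀ × (Fin 3 → Fin n) => ¬ Interior k₀ n p.2)) X (2 * β)
      fun p _ => hbdry p
    rwa [nsmul_eq_mul] at this
  -- the class deficit
  have hdef' : ∑ m, 2 * (r m - lev m) ≤ -(2 * N₀ * δ) := by
    have h1 : ∑ m, 2 * (r m - lev m) = 2 * (∑ m, r m) - 2 * ∑ m, lev m := by
      rw [← Finset.mul_sum, Finset.sum_sub_distrib]
      ring
    rw [h1]
    have h2 : ∑ m, r m ≤ (∑ m, lev m) - N₀ * δ := by simp only [hr, hlev]; exact hdef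
    linarith only [h2]
  -- interior count bounds
  have hcardI : ((n : ℝ) - 2 * k₀) ^ 3 ≤ (interiorSet k₀ n).card := by
    have h := card_interior_ge (k₀ := k₀) (n := n) (by omega)
    have h' : (((n - 2 * k₀) ^ 3 : ℕ) : ℝ) ≤ (interiorSet k₀ n).card := by exact_mod_cast h
    have hsub : ((n - 2 * k₀ : ℕ) : ℝ) = (n : ℝ) - 2 * k₀ := by
      rw [Nat.cast_sub (by omega)]
      push_cast
      ring
    rw [Nat.cast_pow, hsub] at h'
    exact h'
  have harith := block_arith hδ hβ0 hn4 hn1 hbig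
  have hN₀' : (1 : ℝ) ≤ N₀ := by exact_mod_cast hN₀
  -- `#I · T ≤ u³ · T` for the non-positive class deficit `T`
  have hT0 : ∑ m, 2 * (r m - lev m) ≤ 0 := by
    have : (0 : ℝ) ≤ 2 * N₀ * δ := by positivity
    linarith only [hdef', this]
  have hIle : ((interiorSet k₀ n).card : ℝ) * ∑ m, 2 * (r m - lev m) ≤ ((n : ℝ) - 2 * k₀) ^ 3 * (-(2 * N₀ * δ)) := by
    have h1 : ((interiorSet k₀ n).card : ℝ) * ∑ m, 2 * (r m - lev m) ≤ ((n : ℝ) - 2 * k₀) ^ 3 * ∑ m, 2 * (r m - lev m) :=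
      mul_le_mul_of_nonpos_right hcardI hT0
    have h2 : ((n : ℝ) - 2 * k₀) ^ 3 * ∑ m, 2 * (r m - lev m) ≤ ((n : ℝ) - 2 * k₀) ^ 3 * (-(2 * N₀ * δ)) := by
      have hu : (0 : ℝ) ≤ ((n : ℝ) - 2 * k₀) ^ 3 := by
        have : (0 : ℝ) ≤ (n : ℝ) - 2 * k₀ := by
          have : 4 * (k₀ : ℝ) ≤ n := by exact_mod_cast hn4
          linarith
        positivity
      exact mul_le_mul_of_nonneg_left hdef' hu
    exact h1.trans h2
  have hBle : (N₀ : ℝ) * ((n : ℝ) ^ 3 - (interiorSet k₀ n).card) * (2 * β) ≤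
      N₀ * ((n : ℝ) ^ 3 - ((n : ℝ) - 2 * k₀) ^ 3) * (2 * β) := by
    have h1 : (n : ℝ) ^ 3 - (interiorSet k₀ n).card ≤ (n : ℝ) ^ 3 - ((n : ℝ) - 2 * k₀) ^ 3 := by linarith only [hcardI]
    have hN₀0 : (0 : ℝ) ≤ N₀ := by linarith only [hN₀']
    have h2β : (0 : ℝ) ≤ 2 * β := by linarith only [hβ0]
    have := mul_le_mul_of_nonneg_left h1 hN₀0
    exact mul_le_mul_of_nonneg_right this h2β
  -- `2 N₀ (β (n³ − u³) − δ u³) < 0`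
  have hneg : ((n : ℝ) - 2 * k₀) ^ 3 * (-(2 * N₀ * δ)) + N₀ * ((n : ℝ) ^ 3 - ((n : ℝ) - 2 * k₀) ^ 3) * (2 * β) < 0 := by
    have : ((n : ℝ) - 2 * k₀) ^ 3 * (-(2 * N₀ * δ)) + N₀ * ((n : ℝ) ^ 3 - ((n : ℝ) - 2 * k₀) ^ 3) * (2 * β) =
        2 * N₀ * (β * ((n : ℝ) ^ 3 - ((n : ℝ) - 2 * k₀) ^ 3) - δ * ((n : ℝ) - 2 * k₀) ^ 3) := by ring
    rw [this]
    have h2N : (0 : ℝ) < 2 * N₀ := by linarith only [hN₀']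
    have hin : β * ((n : ℝ) ^ 3 - ((n : ℝ) - 2 * k₀) ^ 3) - δ * ((n : ℝ) - 2 * k₀) ^ 3 < 0 := by linarith only [harith]
    exact mul_neg_of_pos_of_neg h2N hin
  rw [hsplit, hI] at hsumX
  linarith only [hsumX, hB, hIle, hBle, hneg]

/-! ## §2. Flag patterns and monotonicity -/

/-- Loosening the tolerance keeps a capped-good site capped-good. [folklore] -/
theorem goodAtScale_mono {η η' D : ℝ} (h : η ≤ η') {M : ℕ} {z : Fin M → E3} {c : Fin M} (hg : GoodAtScale η D z c) :
    GoodAtScale η' D z c := by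
  obtain ⟨d, η₀, γ, A, hdD, hor⟩ := hg
  refine ⟨d, η₀, γ, A, hdD, ?_⟩
  rcases hor with ⟨t, hd, hγ, hη, hrest⟩ | ⟨t, hd, hγ, hη, hrest⟩
  · exact Or.inl ⟨t, hd, hγ, hη.trans_le h, hrest⟩
  · exact Or.inr ⟨t, hd, hγ, hη.trans_le h, hrest⟩

/-- Loosening the tolerance keeps a maybe-good site maybe-good; contrapositively a `η'`-badness certificate is an `η`-badness certificate for every
`η ≤ η'`. [folklore] -/
theorem not_maybeGoodAt_anti {η η' D : ℝ} (h : η ≤ η') {M : ℕ} {z : Fin M → E3} {c : Fin M} (hb : ¬ MaybeGoodAt η' D z c) :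
    ¬ MaybeGoodAt η D z c := by
  rintro (hg | hfar)
  · exact hb (Or.inl (goodAtScale_mono h hg))
  · exact hb (Or.inr hfar)

/-- The ALL-BAD flag pattern `i = 0`. [folklore] -/
theorem flags_of_allBad {η D : ℝ} {N₀ M : ℕ} {Z : Fin M → E3} {cidx : Fin N₀ → Fin M} (hbad : ∀ m, ¬ MaybeGoodAt η D Z (cidx m)) :
    ∀ m, ((fun _ : Fin N₀ => (0 : ℝ)) m = 1 ∧ GoodAtScale η D Z (cidx m)) ∨ ((fun _ : Fin N₀ => (0 : ℝ)) m = 0 ∧ ¬ MaybeGoodAt η D Z (cidx m)) :=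
  fun m => Or.inr ⟨rfl, hbad m⟩

/-- The ALL-GOOD flag pattern `i = 1`. [folklore] -/
theorem flags_of_good {η D : ℝ} {N₀ M : ℕ} {Z : Fin M → E3} {cidx : Fin N₀ → Fin M} (hgood : ∀ m, GoodAtScale η D Z (cidx m)) :
    ∀ m, ((fun _ : Fin N₀ => (1 : ℝ)) m = 1 ∧ GoodAtScale η D Z (cidx m)) ∨ ((fun _ : Fin N₀ => (1 : ℝ)) m = 0 ∧ ¬ MaybeGoodAt η D Z (cidx m)) :=
  fun m => Or.inl ⟨rfl, hgood m⟩

/-! ## §3. The Schur-cut residuals on flagged / all-bad cells -/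

/-- ★ **T′♭ DIES FOR EVERY `C_T` ON AN ALL-BAD CELL**: every class centre not `(η₁, D)`-maybe-good (`η₀ ≤ η₁ ≤ 3/10`), mean priced `W`-site energy
below the interior level `eUp + κ_T` by `δ > 0` ⟹ `¬ SchurTopologicalPricing η₀ η₁ w ω A eUp κ_T C_T`.  (hand-1's `cell_T_1255`: every site `1/8`-bad.)
[folklore] -/
theorem not_schurTopologicalPricing_of_cell_allBad {N₀ M k₀ : ℕ} {x : Fin N₀ → E3} {a b : Fin 3 → E3} {cB ϱ diam : ℝ} (hN₀ : 1 ≤ N₀)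
    (hsep : PerSep x a) (hdual : ∀ j k, inner ℝ (b j) (a k) = if j = k then (1 : ℝ) else 0) (hb : ∀ j, ‖b j‖ ≤ cB)
    (hdiam : DiamLE x diam) (hk₀ : cB * (ϱ + diam) < k₀ + 1)
    {μ : Fin M → Fin N₀} {σ : Fin M → Fin 3 → ℤ} (hμσ : Function.Injective fun q => (μ q, σ q)) (hσ : ∀ q k, |σ q k| ≤ k₀)
    (hsup : ∀ (m : Fin N₀) (s : Fin 3 → ℤ), (∀ k, |s k| ≤ k₀) → ∃ q, μ q = m ∧ σ q = s)
    {cidx : Fin N₀ → Fin M} (hc : ∀ m, μ (cidx m) = m ∧ σ (cidx m) = 0)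
    {w ω : ℝ → ℝ} {A R Wsup : ℝ} (hR0 : 0 ≤ R) (hW : ∀ r, R ≤ r → effPot w ω A r = 0) (hRϱ : R ≤ ϱ)
    (hWle : ∀ r, (7 : ℝ) / 10 ≤ r → effPot w ω A r ≤ Wsup) (hWsup : 0 ≤ Wsup)
    {η₀ η₁ D : ℝ} (hD : 13 / 10 * D + 1 ≤ ϱ) (hη₀₁ : η₀ ≤ η₁) (hη₁ : η₁ ≤ 3 / 10)
    (hbad : ∀ m, ¬ MaybeGoodAt η₁ D (superMotif x a μ σ) (cidx m))
    {eUp κT δ : ℝ} (hδ : 0 < δ)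
    (hdef : ∑ m, (((∑ q, effPot w ω A (dist (x m) (superMotif x a μ σ q))) - effPot w ω A 0) / 2 - A) ≤ N₀ * (eUp + κT - δ))
    (CT : ℝ) : ¬ SchurTopologicalPricing η₀ η₁ w ω A eUp κT CT := fun h =>
  not_pairLevelLaw_of_cell_flags hN₀ hsep hdual hb hdiam hk₀ hμσ hσ hsup hc hR0 hW hRϱ hWle hWsup hD (hη₀₁.trans hη₁) hη₁
    (flags_of_allBad fun m => not_maybeGoodAt_anti hη₀₁ (hbad m)) (flags_of_allBad hbad) hδ
    (hdef.trans (le_of_eq (by simp; ring))) (pairLevelLaw_of_schurTopologicalPricing h)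

/-- **FRG♭ DIES FOR EVERY `C` ON AN ALL-BAD CELL**: every class centre not `(1/20, D)`-maybe-good, mean priced site energy below `e₁` by `δ > 0`
⟹ `¬ SchurRangeGap w ω A e₁ C`. [folklore] -/
theorem not_schurRangeGap_of_cell_allBad {N₀ M k₀ : ℕ} {x : Fin N₀ → E3} {a b : Fin 3 → E3} {cB ϱ diam : ℝ} (hN₀ : 1 ≤ N₀)
    (hsep : PerSep x a) (hdual : ∀ j k, inner ℝ (b j) (a k) = if j = k then (1 : ℝ) else 0) (hb : ∀ j, ‖b j‖ ≤ cB)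
    (hdiam : DiamLE x diam) (hk₀ : cB * (ϱ + diam) < k₀ + 1)
    {μ : Fin M → Fin N₀} {σ : Fin M → Fin 3 → ℤ} (hμσ : Function.Injective fun q => (μ q, σ q)) (hσ : ∀ q k, |σ q k| ≤ k₀)
    (hsup : ∀ (m : Fin N₀) (s : Fin 3 → ℤ), (∀ k, |s k| ≤ k₀) → ∃ q, μ q = m ∧ σ q = s)
    {cidx : Fin N₀ → Fin M} (hc : ∀ m, μ (cidx m) = m ∧ σ (cidx m) = 0)
    {w ω : ℝ → ℝ} {A R Wsup : ℝ} (hR0 : 0 ≤ R) (hW : ∀ r, R ≤ r → effPot w ω A r = 0) (hRϱ : R ≤ ϱ)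
    (hWle : ∀ r, (7 : ℝ) / 10 ≤ r → effPot w ω A r ≤ Wsup) (hWsup : 0 ≤ Wsup)
    {D : ℝ} (hD : 13 / 10 * D + 1 ≤ ϱ) (hbad : ∀ m, ¬ MaybeGoodAt (1 / 20) D (superMotif x a μ σ) (cidx m))
    {e₁ δ : ℝ} (hδ : 0 < δ)
    (hdef : ∑ m, (((∑ q, effPot w ω A (dist (x m) (superMotif x a μ σ q))) - effPot w ω A 0) / 2 - A) ≤ N₀ * (e₁ - δ))
    (C : ℝ) : ¬ SchurRangeGap w ω A e₁ C := fun h =>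
  not_pairLevelLaw_of_cell_flags hN₀ hsep hdual hb hdiam hk₀ hμσ hσ hsup hc hR0 hW hRϱ hWle hWsup hD (by norm_num) (by norm_num)
    (flags_of_allBad hbad) (flags_of_allBad hbad) hδ (hdef.trans (le_of_eq (by simp; ring))) (pairLevelLaw_of_schurRangeGap (1 / 20) h)

/-- **E′♭ DIES ON A FLAGGED CELL for given `C_E, D_E`**: certified flags `i₀` (at `η₀`), `i₁` (at `η₁`), priced site energies below the class levels
`(eUp − D_E) − (κ_E + C_E)·i₀ m + (κ_E + D_E)·i₁ m` in total by `N₀ δ` ⟹ `¬ SchurElasticPricing η₀ η₁ w ω A eUp κ_E C_E D_E` (mixed witnesses: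
strained classes pay `eUp + κ_E`, doubly-bad classes `eUp − D_E`, good classes `eUp − C_E`). [folklore] -/
theorem not_schurElasticPricing_of_cell_flags {N₀ M k₀ : ℕ} {x : Fin N₀ → E3} {a b : Fin 3 → E3} {cB ϱ diam : ℝ} (hN₀ : 1 ≤ N₀)
    (hsep : PerSep x a) (hdual : ∀ j k, inner ℝ (b j) (a k) = if j = k then (1 : ℝ) else 0) (hb : ∀ j, ‖b j‖ ≤ cB)
    (hdiam : DiamLE x diam) (hk₀ : cB * (ϱ + diam) < k₀ + 1)
    {μ : Fin M → Fin N₀} {σ : Fin M → Fin 3 → ℤ} (hμσ : Function.Injective fun q => (μ q, σ q)) (hσ : ∀ q k, |σ q k| ≤ k₀)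
    (hsup : ∀ (m : Fin N₀) (s : Fin 3 → ℤ), (∀ k, |s k| ≤ k₀) → ∃ q, μ q = m ∧ σ q = s)
    {cidx : Fin N₀ → Fin M} (hc : ∀ m, μ (cidx m) = m ∧ σ (cidx m) = 0)
    {w ω : ℝ → ℝ} {A R Wsup : ℝ} (hR0 : 0 ≤ R) (hW : ∀ r, R ≤ r → effPot w ω A r = 0) (hRϱ : R ≤ ϱ)
    (hWle : ∀ r, (7 : ℝ) / 10 ≤ r → effPot w ω A r ≤ Wsup) (hWsup : 0 ≤ Wsup)
    {η₀ η₁ D : ℝ} (hD : 13 / 10 * D + 1 ≤ ϱ) (hη₀ : η₀ ≤ 3 / 10) (hη₁ : η₁ ≤ 3 / 10) {i₀ i₁ : Fin N₀ → ℝ}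
    (hfl₀ : ∀ m, (i₀ m = 1 ∧ GoodAtScale η₀ D (superMotif x a μ σ) (cidx m)) ∨ (i₀ m = 0 ∧ ¬ MaybeGoodAt η₀ D (superMotif x a μ σ) (cidx m)))
    (hfl₁ : ∀ m, (i₁ m = 1 ∧ GoodAtScale η₁ D (superMotif x a μ σ) (cidx m)) ∨ (i₁ m = 0 ∧ ¬ MaybeGoodAt η₁ D (superMotif x a μ σ) (cidx m)))
    {eUp κE CE DE δ : ℝ} (hδ : 0 < δ)
    (hdef : ∑ m, (((∑ q, effPot w ω A (dist (x m) (superMotif x a μ σ q))) - effPot w ω A 0) / 2 - A) ≤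
      (∑ m, ((eUp - DE) + (-(κE + CE)) * i₀ m + (κE + DE) * i₁ m)) - N₀ * δ) :
    ¬ SchurElasticPricing η₀ η₁ w ω A eUp κE CE DE := fun h =>
  not_pairLevelLaw_of_cell_flags hN₀ hsep hdual hb hdiam hk₀ hμσ hσ hsup hc hR0 hW hRϱ hWle hWsup hD hη₀ hη₁ hfl₀ hfl₁ hδ hdef
    (pairLevelLaw_of_schurElasticPricing h)

/-- **T′♭ on a flagged cell for a given `C_T`** (levels `(eUp + κ_T) − C_T·i₀ m − κ_T·i₁ m`). [folklore] -/
theorem not_schurTopologicalPricing_of_cell_flags {N₀ M k₀ : ℕ} {x : Fin N₀ → E3} {a b : Fin 3 → E3} {cB ϱ diam : ℝ} (hN₀ : 1 ≤ N₀)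
    (hsep : PerSep x a) (hdual : ∀ j k, inner ℝ (b j) (a k) = if j = k then (1 : ℝ) else 0) (hb : ∀ j, ‖b j‖ ≤ cB)
    (hdiam : DiamLE x diam) (hk₀ : cB * (ϱ + diam) < k₀ + 1)
    {μ : Fin M → Fin N₀} {σ : Fin M → Fin 3 → ℤ} (hμσ : Function.Injective fun q => (μ q, σ q)) (hσ : ∀ q k, |σ q k| ≤ k₀)
    (hsup : ∀ (m : Fin N₀) (s : Fin 3 → ℤ), (∀ k, |s k| ≤ k₀) → ∃ q, μ q = m ∧ σ q = s)
    {cidx : Fin N₀ → Fin M} (hc : ∀ m, μ (cidx m) = m ∧ σ (cidx m) = 0)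
    {w ω : ℝ → ℝ} {A R Wsup : ℝ} (hR0 : 0 ≤ R) (hW : ∀ r, R ≤ r → effPot w ω A r = 0) (hRϱ : R ≤ ϱ)
    (hWle : ∀ r, (7 : ℝ) / 10 ≤ r → effPot w ω A r ≤ Wsup) (hWsup : 0 ≤ Wsup)
    {η₀ η₁ D : ℝ} (hD : 13 / 10 * D + 1 ≤ ϱ) (hη₀ : η₀ ≤ 3 / 10) (hη₁ : η₁ ≤ 3 / 10) {i₀ i₁ : Fin N₀ → ℝ}
    (hfl₀ : ∀ m, (i₀ m = 1 ∧ GoodAtScale η₀ D (superMotif x a μ σ) (cidx m)) ∨ (i₀ m = 0 ∧ ¬ MaybeGoodAt η₀ D (superMotif x a μ σ) (cidx m)))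
    (hfl₁ : ∀ m, (i₁ m = 1 ∧ GoodAtScale η₁ D (superMotif x a μ σ) (cidx m)) ∨ (i₁ m = 0 ∧ ¬ MaybeGoodAt η₁ D (superMotif x a μ σ) (cidx m)))
    {eUp κT CT δ : ℝ} (hδ : 0 < δ)
    (hdef : ∑ m, (((∑ q, effPot w ω A (dist (x m) (superMotif x a μ σ q))) - effPot w ω A 0) / 2 - A) ≤
      (∑ m, ((eUp + κT) + (-CT) * i₀ m + (-κT) * i₁ m)) - N₀ * δ) :
    ¬ SchurTopologicalPricing η₀ η₁ w ω A eUp κT CT := fun h =>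
  not_pairLevelLaw_of_cell_flags hN₀ hsep hdual hb hdiam hk₀ hμσ hσ hsup hc hR0 hW hRϱ hWle hWsup hD hη₀ hη₁ hfl₀ hfl₁ hδ hdef
    (pairLevelLaw_of_schurTopologicalPricing h)

end Summit.AtomisticToContinuum.Crystallization.Theorems.FrustratedLawDichotomyPeriodicBlockFlags

end
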